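import Summits.QuantumFields.YangMills.Theorems.AlphaInputsT3ACv3LinearLiftSegFlat
import Summits.QuantumFields.YangMills.Theorems.UnitScaleTiltProp7TowerClosenessStairs
import HarnessLib

/-!
# Route `UnitScaleTilt`, crux K1 «MinimiserStabilityRegPr» (stmt-QuantumFields-19200), route-R E′ (A′) «HCOW-VIA-Σ», row P-A2 «JOINT-Σ», file F3″-B2a —
# THE BLOCK MEAN CONTRACTS SITE MASSES BY `L^{−d}`: `Σ_y (|Idx|⁻¹·Σ_i f(x_i(y)))² ≤ (L^d)⁻¹·Σ_x f(x)²`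

Cell `ym3-torus`, width seat `ym3-torus-px22` (gen 3); ★p1 g17 WORD 10 (4) «F3″ → px22»; LOCATE `LOCATE-PA2-F3-LEVELMASSES-px22g3.md` §2.  THE POINT.  In the one-step
accumulated-frame inequality ✓ `Prop7AccumulatedFrameStep.norm_frameAccU_succ_sub_one_le` the previous frames enter through the MEAN over the index family `Idx P` of their values at
the stair ends `x_i(y) = emb y + disp(stairWord σ (off r))` — which are exactly the block's sites `blockSite y r` (independent of the two orderings).  Summing the SQUARE of that mean
over the coarse sites therefore contracts the site mass by `(L^d)⁻¹` (Cauchy–Schwarz on each block + the block tiling ✓ `LinearLiftGauge.sum_blockSite_eq`): this is the `L^{−3}` in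
`q = 4L^{−3} + c′L³δ²` of ✓ `Prop7TwistedLevelMassInduction.frameMass_induction`'s hypothesis.  THEOREMS ONLY (0 `def`, 0 `sorry`); `--supports stmt-QuantumFields-19200`, count-neutral.
YM₃ on T³ is a ladder rung (R3), not the Clay problem; nothing here claims the stub, the crux, d = 4 or the gap.

References: T. Bałaban, CMP 109 (1987) 249–301 [Balaban1987RG1] ((0.3)–(0.4) pp.252–253); CMP 98 (1985) 17–51 [Balaban1985Averaging] ((82) p.30, (97) p.32).
-/

set_option autoImplicit false

noncomputable section

open scoped BigOperators

namespace Summit.QuantumFields.YangMills.Theorems.Prop7BlockMeanContraction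

open Finset
open Literature.MathematicalPhysics.QuantumFieldTheory.Balaban1983to89
open T4Continuum T4ReflectionCone BlockAveraging AveragingRT
open B10Eq27TorusAxialLog (transl)
open B7Prop1Explicit (disp)
open Summit.QuantumFields.YangMills.Theorems.LinearLiftGauge (sum_Idx_fst card_Idx sum_blockSite_eq)
open Summit.QuantumFields.YangMills.Theorems.AbelianEML (offPt offPt_off_eq_blockSite)
open Summit.QuantumFields.YangMills.Theorems.Prop7TowerClosenessOfRegPr (walkEnd_eq_transl_disp' walkEnd_stairWord_eq)

variable {P : Params} {k : ℕ}

/-- ★ **THE STAIR ENDS ARE THE BLOCK SITES**: `emb y + disp(stairWord σ (off r)) = blockSite y r` for every ordering `σ` (✓ `walkEnd_stairWord_eq`, ✓ `offPt_off_eq_blockSite`).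
[cite: Balaban1987RG1, (0.3) p.252] -/
theorem transl_emb_disp_stairWord_eq_blockSite (y : Site P (k + 1)) (i : Idx P) :
    transl (emb y) (disp (stairWord i.2.1 (off i.1))) = Site.blockSite y i.1 := by
  rw [← walkEnd_eq_transl_disp', walkEnd_stairWord_eq (emb y) i.2.1 (Equiv.refl _) (off i.1), ← offPt_off_eq_blockSite]
  rfl

/-- ★ **THE INDEX MEAN IS THE BLOCK MEAN**: `|Idx|⁻¹·Σ_i f(x_i(y)) = (L^d)⁻¹·Σ_r f(blockSite y r)` (the two orderings drop out: ✓ `sum_Idx_fst`, ✓ `card_Idx`).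
[cite: Balaban1987RG1, (0.4) p.253] -/
theorem idxMean_eq_blockMean (f : Site P k → ℝ) (y : Site P (k + 1)) :
    (Fintype.card (Idx P) : ℝ)⁻¹ * ∑ i : Idx P, f (transl (emb y) (disp (stairWord i.2.1 (off i.1))))
      = ((P.L : ℝ) ^ P.d)⁻¹ * ∑ r : Fin P.d → Fin P.L, f (Site.blockSite y r) := by
  have e : ∀ i : Idx P, f (transl (emb y) (disp (stairWord i.2.1 (off i.1)))) = (fun r : Fin P.d → Fin P.L => f (Site.blockSite y r)) i.1 := fun i => by
    rw [transl_emb_disp_stairWord_eq_blockSite]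
  rw [Finset.sum_congr rfl (fun i _ => e i), sum_Idx_fst (fun r => f (Site.blockSite y r)), card_Idx]
  have hP : (0 : ℝ) < Fintype.card (Equiv.Perm (Fin P.d) × Equiv.Perm (Fin P.d)) := Nat.cast_pos.2 Fintype.card_pos
  have hL : (0 : ℝ) < (P.L : ℝ) ^ P.d := pow_pos (Nat.cast_pos.2 P.L_pos) _
  field_simp

/-- the blocks tile the fine torus: `Σ_y Σ_{x ∈ B(y)} g(x) = Σ_x g(x)` (standing range). [cite: Balaban1987RG1, (0.3) p.252] -/
theorem sum_sum_block_eq (g : Site P k → ℝ) : ∑ y : Site P (k + 1), ∑ x ∈ block y, g x = ∑ x : Site P k, g x := by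
  have e : ∀ y : Site P (k + 1), block y = univ.filter (fun x : Site P k => blockOf x = y) := fun y => by ext x; simp [block]
  simp_rw [e]
  exact Finset.sum_fiberwise_of_maps_to (fun x _ => Finset.mem_univ _) g

/-- ★★★ **THE BLOCK MEAN CONTRACTS SITE MASSES BY `(L^d)⁻¹`**: for every real `f` on the level-`k` sites (standing range `k + 1 ≤ m + K`),
`Σ_{y} (|Idx|⁻¹·Σ_i f(x_i(y)))² ≤ (L^d)⁻¹·Σ_x f(x)²` — Cauchy–Schwarz on each block (`L^d` sites) and the block tiling. [cite: Balaban1987RG1, (0.3)-(0.4) pp.252-253; Balaban1985Averaging, (97) p.32] -/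
theorem sum_sq_idxMean_le (hk : k + 1 ≤ P.m + P.K) (f : Site P k → ℝ) :
    ∑ y : Site P (k + 1), ((Fintype.card (Idx P) : ℝ)⁻¹ * ∑ i : Idx P, f (transl (emb y) (disp (stairWord i.2.1 (off i.1))))) ^ 2
      ≤ ((P.L : ℝ) ^ P.d)⁻¹ * ∑ x : Site P k, f x ^ 2 := by
  have hL : (0 : ℝ) < (P.L : ℝ) ^ P.d := pow_pos (Nat.cast_pos.2 P.L_pos) _
  have hcard : ((Finset.univ : Finset (Fin P.d → Fin P.L)).card : ℝ) = (P.L : ℝ) ^ P.d := by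
    simp only [Finset.card_univ, Fintype.card_fun, Fintype.card_fin]; push_cast; ring
  -- blockwise Cauchy–Schwarz
  have hblock : ∀ y : Site P (k + 1), ((Fintype.card (Idx P) : ℝ)⁻¹ * ∑ i : Idx P, f (transl (emb y) (disp (stairWord i.2.1 (off i.1))))) ^ 2
      ≤ ((P.L : ℝ) ^ P.d)⁻¹ * ∑ x ∈ block y, f x ^ 2 := by
    intro y
    rw [idxMean_eq_blockMean, ← sum_blockSite_eq hk y (fun x => f x ^ 2)]
    have hcs := sq_sum_le_card_mul_sum_sq (s := (Finset.univ : Finset (Fin P.d → Fin P.L))) (f := fun r => f (Site.blockSite y r))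
    rw [hcard] at hcs
    rw [mul_pow, sq]
    have e : ((P.L : ℝ) ^ P.d)⁻¹ * ((P.L : ℝ) ^ P.d)⁻¹ * (∑ r : Fin P.d → Fin P.L, f (Site.blockSite y r)) ^ 2
        ≤ ((P.L : ℝ) ^ P.d)⁻¹ * ((P.L : ℝ) ^ P.d)⁻¹ * ((P.L : ℝ) ^ P.d * ∑ r : Fin P.d → Fin P.L, f (Site.blockSite y r) ^ 2) :=
      mul_le_mul_of_nonneg_left hcs (by positivity)
    refine e.trans (le_of_eq ?_)
    field_simp
  refine (Finset.sum_le_sum fun y _ => hblock y).trans (le_of_eq ?_)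
  rw [← Finset.mul_sum, sum_sum_block_eq]

end Summit.QuantumFields.YangMills.Theorems.Prop7BlockMeanContraction

end
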